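import Summits.BirchSwinnertonDyer.Rank1Residual.AdditivePotMult.RankZeroShaAnIdentity
import HarnessLib
import HarnessLib.Audit.Tags

/-!
# O5 (t′) — KL3 part 17: STEP-0 PROPER — Gross–Zagier at a Heegner pair in BSD currency, `p`-adically

Research route (cell `b2b-bsdres`, class O5 = tame potentially-supersingular additive `p = 3` (t′), `9 ‖ N`);
**honest framing**: THEOREMS ONLY — 0 `def`, 0 `@[conjecture]`, 0 Literature facts, no `sorry`; the
published inputs (Gross–Zagier, Kolyvagin, Gross–Zagier–Kolyvagin over `ℚ`, modularity) enter as the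
tree's named facts, as binders. Nothing booked; no mark / label / count / tier of `RESIDUAL-MAP.md` moves;
O5 stays OPEN as a class.

## What this file proves

STEP-0 of the KL3 chain (o5-r2 GEN 17 `HeegnerIndexBSDAt`, GEN 21 parts 9/15 binder `hstep0`, GEN 22
part 16 binder `hGZ0`) was carried as a DISPLAYED per-pair input: "Gross–Zagier for the companion pair
`(G, G^{(d_K)})` in BSD currency, `3`-adically". It is in fact a COROLLARY of two theorems already in the
tree, which do the Gross–Zagier / period / height / torsion bookkeeping EXACTLY at an odd prime `p`:

* `X11b.exists_shaAn_padicVal_eq_of_heegner` (multr1-p2; case `ord_{s=1} L(G,s) = 1`, twist of analytic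
  rank `0`): `#Ш_an(G) = q ∈ ℚ` with
  `ord_p q + ord_p (L(G_d,1)/Ω_{G_d}) + ord_p ∏c(G) + 2 ord_p #G_d(ℚ)_tors = 2 ord_p [G(K):ℤP]`;
* `AdditivePotMult.exists_shaAn_padicVal_eq_of_heegner_rankZero` (additive-p1; case
  `ord_{s=1} L(G,s) = 0`, twist of analytic rank `1`): the same with the two curves exchanged.

Converting the rank-`0` member's datum `L(·,1)/Ω` into its `#Ш_an` (`#Ш_an = L(1)·#tors²/(Ω·∏c)`,
`Reg = 1` in rank `0`) makes the torsion terms CANCEL, and the two cases merge into the symmetric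

  `padicVal_shaAn_pair_of_heegner`:
  `ord_p #Ш_an(G) + ord_p #Ш_an(G_d) + ord_p ∏_ℓ c_ℓ(G) + ord_p ∏_ℓ c_ℓ(G_d) = 2 · ord_p [G(K) : ℤ P]`

for EVERY globally minimal `G/ℚ`, odd `p`, imaginary quadratic `K` (Heegner for `N`, `p ∤ #𝓞_K^×`),
Heegner point `P ∈ G(K)` of a datum with `p ∤ c` NON-TORSION, minimal twist model `G_d = Cd • G^{(d_K)}`
with `ord_p u(Cd) = 0`, both analytic ranks `≤ 1`, and any rationals `q₀ = #Ш_an(G)`, `q₁ = #Ш_an(G_d)`.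
Which case holds is decided inside: Kolyvagin gives `rank G(K) = 1`, so `r_an(G) + r_an(G_d) = 1`
(`mordellWeilRank_baseChange_quadratic_holds` + GZK over `ℚ`). General odd `p`; the O5 chain uses `p = 3`.

§2 restates it in the currency of the chain's binder `hstep0` (`2·ord₃ ∏c(G) + 2·ord₃ c_{D′}`) under
`3 ∤ ∏c(G)`, `3 ∤ ∏c(G_d)`, `3 ∤ c_{D′}` — the form part 18 (`…StepZeroEnd`) plugs into the END of record.

[cite: GrossZagier1986, Thm. I.6.3 with V.§2 (pp. 310–312)] [cite: JetchevSkinnerWan2017, §7.4.1 (eq:gz)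
and §7.3.1 (eq:tamK), pp. 29–30] [cite: GrossLMS1991, §1 (1.1), Conj. 1.2 (p. 237)]
[cite: Miller2011LMS, §1 and Def. 1.1 (arXiv:1010.2431 p. 3)]

## TYPER PLACEMENT NOTE (cc-typer-5 GEN 18 = O5 §3.5 / O6 §3.4 typer of record; by-name ask A-O5-G22-1 of o5-r2 GEN 22, HOME/INBOX.md l.14240
'(i) place NOW — TREE imports only — parts 17, 19; (ii) AFTER 14, 15 and (i): part 18'; cc-lead GEN 78 l.14242 docket reading)

Source: `HOME/b2b-bsdres-o5-r2/gen22/lean/HeegnerLogTransportStepZero.lean` sha16 `62dd4b2fa081f31a` (230 l.; `gen22/SHA16.txt`; o5-r2's standalone farm check rc 0 / 0 warnings / 0 sorry, axioms std;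
joint scratch of record `gen22/lean/scratch/scratch_p9_14_15_16_17_19_18.lean` 07c7b90c508ff885 rc 0), re-hashed by the typer right before writing; THIS file = KL3 part
17 = the source VERBATIM + this paragraph (imports, module text, every declaration block byte-identical; script `class-closure/typer-5/gen18/g22_place.py`); the typer's
own standalone farm check (rc 0 / 0 warnings, axioms std) and DEDUP (`lean search --decl` on the new names: no match) precede the proposal.
CONTENT LABELS (source, unchanged): THEOREMS ONLY — 0 `def`, 0 `@[conjecture]`, 0 Literature facts (net named-fact debt 0), no `sorry`; published inputs stay displayed
hypotheses BY NAME (Kolyvagin, Gross–Zagier(–Kolyvagin), modularity, …); tree inputs reused BY NAME (`X11b.exists_shaAn_padicVal_eq_of_heegner`,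
`AdditivePotMult.exists_shaAn_padicVal_eq_of_heegner_rankZero`, `selmer_exact_holds`, …), nothing re-proved.  TYPER WORD on cc-lead GEN 78's COLLISION FLAG
(l.14242; harvest-2 GEN 59 MINE E116 l.14241): part 17 is the O5 planner's by-sha file of record for the pair identity (★); a second tree file proving (★)
is declined by the typer — E116 is re-scoped (cc-lead's division) to the A-O5-G22-2 (a)/(b) residual lemmas as ONE leaf importing part 17 BY NAME, harvest-2's pen.
KL3 parts in the tree: 1–3 p340741 / p341262 / p341640, Global p342632, OrdCompanion p343587 + p344465, OrdSelmer p345030 + p345686, OrdTwist p346273, Residual Engine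
p347366 + Residual p348865 + End p350277, BaseSelmer p349318, ExactCount p349954, GoodSelmer p350559, TameTamagawa p350983, RatLogUnit p351404, ResidualEndFacts p352109,
BaseSelmerCount p352220, KrizLiGlue p352538; Literature index lemma p344022, A314 p350088.  HONEST FRAMING (cell `b2b-bsdres`): research route, lane CLASS-CLOSURE
§3.5 O5; CONDITIONAL theorems — nothing asserted beyond the displayed binders, nothing booked, no mark of `RESIDUAL-MAP.md` moves; census = EVIDENCE, never a
Literature fact; O5 OPEN.
-/

noncomputable section

open scoped Classical

open WeierstrassCurve NumberField Literature.NumberTheory.EllipticCurves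
  Literature.NumberTheory.EllipticCurves.ModularForms
  Literature.NumberTheory.EllipticCurves.Rank1Residual
  Literature.NumberTheory.EllipticCurves.KrizLi2019
  Literature.NumberTheory.QuadraticFields

namespace Summit.BirchSwinnertonDyer.Rank1Residual.O5.HeegnerLogTransport

/-! ## §0 Rank-zero unfolding of `#Ш_an` and its valuation -/

/-- **`#Ш_an` in analytic rank `0`, solved for `L(E,1)/Ω`.** For an elliptic `X/ℚ` with
`ord_{s=1} L(X,s) = 0` and `rank X(ℚ) = 0` (so `Reg = 1`), `#Ш_an(X) = L(X,1)·#X(ℚ)_tors²/(Ω·∏c)`; hence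
`#Ш_an(X) = q` gives `L(X,1)/Ω = q·∏c/#tors²`. [cite: Miller2011LMS, §1 (arXiv:1010.2431 p. 3)] -/
theorem entireLFunction_one_div_realPeriodRat_eq_of_shaAn_eq (X : WeierstrassCurve ℚ) [X.IsElliptic]
    (hX : X.analyticRank = 0) (hrk : X.mordellWeilRank = 0) {q : ℚ} (hq : shaAn X = (q : ℂ)) :
    X.entireLFunction 1 / (X.realPeriodRat : ℂ) =
      ((q * X.tamagawaProduct / (X.torsionOrder : ℚ) ^ 2 : ℚ) : ℂ) := by
  have hlead : X.leadingLCoeff = X.entireLFunction 1 := by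
    simp [WeierstrassCurve.leadingLCoeff, hX]
  have hReg : X.regulator = 1 := X.regulator_eq_one_of_rank_zero hrk
  have hΩ : (X.realPeriodRat : ℂ) ≠ 0 := by exact_mod_cast X.realPeriodRat_pos_holds.ne'
  have ht : (X.torsionOrder : ℂ) ≠ 0 := by exact_mod_cast X.torsionOrder_pos_holds.ne'
  have hT : (X.tamagawaProduct : ℂ) ≠ 0 := by exact_mod_cast X.tamagawaProduct_pos_holds.ne'
  have h1 : (q : ℂ) = X.entireLFunction 1 * (X.torsionOrder : ℂ) ^ 2 /
      ((X.realPeriodRat : ℂ) * (X.tamagawaProduct : ℂ) * 1) := by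
    rw [← hq, shaAn_def, hlead, hReg]; push_cast; rfl
  have hL : X.entireLFunction 1 =
      (q : ℂ) * (X.realPeriodRat : ℂ) * (X.tamagawaProduct : ℂ) / (X.torsionOrder : ℂ) ^ 2 := by
    rw [h1]; field_simp
  rw [hL]; push_cast; field_simp

/-- **Valuation of the rank-zero conversion factor**: for `q ≠ 0`,
`ord_p (q·∏c/#tors²) = ord_p q + ord_p ∏c − 2·ord_p #tors`. [folklore] -/
theorem padicValRat_mul_tamagawaProduct_div_torsionOrder_sq (X : WeierstrassCurve ℚ) [X.IsElliptic]
    (p : ℕ) [Fact p.Prime] {q : ℚ} (hq : q ≠ 0) :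
    padicValRat p (q * X.tamagawaProduct / (X.torsionOrder : ℚ) ^ 2) =
      padicValRat p q + padicValNat p X.tamagawaProduct - 2 * padicValNat p X.torsionOrder := by
  have ht : (X.torsionOrder : ℚ) ≠ 0 := by exact_mod_cast X.torsionOrder_pos_holds.ne'
  have hT : (X.tamagawaProduct : ℚ) ≠ 0 := by exact_mod_cast X.tamagawaProduct_pos_holds.ne'
  rw [padicValRat.div (mul_ne_zero hq hT) (pow_ne_zero _ ht), padicValRat.mul hq hT, padicValRat.pow,
    padicValRat.of_nat, padicValRat.of_nat]
  push_cast; ring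

/-! ## §1 STEP-0 proper: the symmetric valuation identity at a Heegner pair -/

/-- **STEP-0 (Gross–Zagier at a Heegner pair, BSD currency, `p`-adically; SYMMETRIC form).** Data:
`G/ℚ` globally minimal of conductor `N` (a datum `Dt : ModularParametrizationData G N` with `p ∤ c(Dt)`),
`K` imaginary quadratic with the Heegner hypothesis for `N` and `p ∤ #𝓞_K^×`, `p` odd, `P ∈ G(K)` the
Heegner point of `Dt`, NON-TORSION; `G_d = Cd • G^{(d_K)}` a globally minimal model of the twist with
`ord_p u(Cd) = 0`; both analytic ranks `≤ 1`; rationals `q₀ = #Ш_an(G)`, `q₁ = #Ш_an(G_d)` (data — NO claim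
on their valuations; they exist by Gross–Zagier–Kolyvagin, not used). PUBLISHED inputs as binders: `hGZ`
(Gross–Zagier), `hKo` (Kolyvagin), `hGZK` (GZK over `ℚ`), `hmod` (modularity). CONCLUSION:
`ord_p q₀ + ord_p q₁ + ord_p ∏_ℓ c_ℓ(G) + ord_p ∏_ℓ c_ℓ(G_d) = 2·ord_p [G(K) : ℤP]`.
Proof: Kolyvagin ⇒ `rank G(K) = 1` ⇒ `r_an(G) + r_an(G_d) = 1`; case `r_an(G) = 1`:
`X11b.exists_shaAn_padicVal_eq_of_heegner` with the twist datum `L(G_d,1)/Ω = q₁·∏c(G_d)/#tors(G_d)²`;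
case `r_an(G) = 0`: `AdditivePotMult.exists_shaAn_padicVal_eq_of_heegner_rankZero` with
`L(G,1)/Ω = q₀·∏c(G)/#tors(G)²`; the torsion terms cancel. [cite: GrossZagier1986, Thm. I.6.3 with V.§2
(pp. 310–312)] [cite: JetchevSkinnerWan2017, §7.4.1 (eq:gz), §7.3.1 (eq:tamK), pp. 29–30]
[cite: Miller2011LMS, §1 and Def. 1.1 (arXiv:1010.2431 p. 3)] -/
theorem padicVal_shaAn_pair_of_heegner
    (G : WeierstrassCurve ℚ) [G.IsElliptic] [G.IsGloballyMinimal] (p : ℕ) [Fact p.Prime]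
    (N : ℕ) [NeZero N] (K : Type) [Field K] [NumberField K]
    (Dt : ModularParametrizationData G N) (H : HeegnerDatum N (NumberField.discr K)) (ι : K →+* ℂ)
    (P : (G.baseChange K).toAffine.Point)
    -- the published inputs (named facts of the tree)
    (hGZ : gross_zagier N G K) (hKo : kolyvagin N G K)
    (hGZK : rank_eq_analyticRank_of_analyticRank_le_one) (hmod : hasEntireLFunction_rat)
    -- the data
    (hK : IsImaginaryQuadratic K) (hHN : SatisfiesHeegnerHypothesis N K)
    (hP : WeierstrassCurve.Affine.Point.map ι.toRatAlgHom P = heegnerPointComplex Dt H)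
    (hPinf : ¬ IsOfFinAddOrder P)
    (hp2 : p ≠ 2) (hc : ¬ (p : ℤ) ∣ Dt.c) (hμ : ¬ p ∣ Units.torsionOrder K)
    (hr : G.analyticRank ≤ 1)
    -- a globally minimal model of the quadratic twist by `d_K`, differing by a `p`-unit
    (Gd : WeierstrassCurve ℚ) [Gd.IsElliptic] [Gd.IsGloballyMinimal] (Cd : VariableChange ℚ)
    (hGd : Cd • G.quadraticTwist (NumberField.discr K : ℚ) = Gd)
    (hu : padicValRat p (Cd.u : ℚ) = 0) (hrd : Gd.analyticRank ≤ 1)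
    -- the rational analytic orders of `Ш` (data)
    {q₀ q₁ : ℚ} (hq₀ : shaAn G = (q₀ : ℂ)) (hq₁ : shaAn Gd = (q₁ : ℂ)) :
    padicValRat p q₀ + padicValRat p q₁ + padicValNat p G.tamagawaProduct +
        padicValNat p Gd.tamagawaProduct =
      2 * padicValNat p (AddSubgroup.zmultiples P).index := by
  obtain ⟨h2, hKtc⟩ := hK
  have hD0 : (NumberField.discr K : ℚ) ≠ 0 := by exact_mod_cast NumberField.discr_ne_zero K
  haveI hEt : (G.quadraticTwist (NumberField.discr K : ℚ)).IsElliptic :=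
    G.isElliptic_quadraticTwist hD0
  haveI hEK : (G.baseChange K).IsElliptic := isElliptic_baseChange' G K
  ---------------------------------------------------------------- Kolyvagin: `rank G(K) = 1`
  have hPH : IsHeegnerPoint N G K P := ⟨Dt, H, ι, hP⟩
  obtain ⟨hrkK, -⟩ := hKo ⟨h2, hKtc⟩ hHN hPH hPinf
  ---------------------------------------------------------------- ranks over `ℚ`: `r_an(G) + r_an(G_d) = 1`
  have hrt : (G.quadraticTwist (NumberField.discr K : ℚ)).analyticRank = Gd.analyticRank := by
    rw [← hGd, analyticRank_smul]
  have hrkG : G.mordellWeilRank = G.analyticRank := (hGZK G hr).1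
  have hrkt : (G.quadraticTwist (NumberField.discr K : ℚ)).mordellWeilRank = Gd.analyticRank := by
    rw [(hGZK _ (by rw [hrt]; exact hrd)).1, hrt]
  have hsum : G.analyticRank + Gd.analyticRank = 1 := by
    have hadd := mordellWeilRank_baseChange_quadratic_holds G K h2
    rw [hrkK, hrkG, hrkt] at hadd
    omega
  have hLt' : (G.quadraticTwist (NumberField.discr K : ℚ)).entireLFunction = Gd.entireLFunction := by
    rw [← hGd, entireLFunction_smul]
  have hΩG : (G.realPeriodRat : ℂ) ≠ 0 := by exact_mod_cast G.realPeriodRat_pos_holds.ne'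
  have hΩd : (Gd.realPeriodRat : ℂ) ≠ 0 := by exact_mod_cast Gd.realPeriodRat_pos_holds.ne'
  rcases (show (G.analyticRank = 1 ∧ Gd.analyticRank = 0) ∨ (G.analyticRank = 0 ∧ Gd.analyticRank = 1) by
      omega) with ⟨hA, hB⟩ | ⟨hA, hB⟩
  · ---------------------------------------------------------------- case `r_an(G) = 1`, `r_an(G_d) = 0`
    have hLd1 : Gd.entireLFunction 1 ≠ 0 := (Gd.analyticRank_eq_zero_iff_holds (hmod Gd)).1 hB
    have hLt : (G.quadraticTwist (NumberField.discr K : ℚ)).entireLFunction 1 ≠ 0 := by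
      rw [hLt']; exact hLd1
    have hrkd : Gd.mordellWeilRank = 0 := by rw [(hGZK Gd hrd).1, hB]
    have hqd := entireLFunction_one_div_realPeriodRat_eq_of_shaAn_eq Gd hB hrkd hq₁
    have hq₁0 : q₁ ≠ 0 := by
      intro h0
      apply hLd1
      rw [(div_eq_iff hΩd).mp hqd, h0]
      simp
    obtain ⟨-, -, -, q, hq, hval⟩ :=
      X11b.exists_shaAn_padicVal_eq_of_heegner G p N K Dt H ι P hGZ hKo hGZK hmod ⟨h2, hKtc⟩ hHN hP
        hp2 hc hμ hA hLt Gd Cd hGd hu _ hqd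
    have hqq : q = q₀ := Rat.cast_injective (α := ℂ) (hq.symm.trans hq₀)
    rw [hqq, padicValRat_mul_tamagawaProduct_div_torsionOrder_sq Gd p hq₁0] at hval
    omega
  · ---------------------------------------------------------------- case `r_an(G) = 0`, `r_an(G_d) = 1`
    have hL1 : G.entireLFunction 1 ≠ 0 := (G.analyticRank_eq_zero_iff_holds (hmod G)).1 hA
    have hrk0 : G.mordellWeilRank = 0 := by rw [hrkG, hA]
    have hq0 := entireLFunction_one_div_realPeriodRat_eq_of_shaAn_eq G hA hrk0 hq₀
    have hq₀0 : q₀ ≠ 0 := by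
      intro h0
      apply hL1
      rw [(div_eq_iff hΩG).mp hq0, h0]
      simp
    obtain ⟨-, -, -, q, hq, hval⟩ :=
      AdditivePotMult.exists_shaAn_padicVal_eq_of_heegner_rankZero G p N K Dt H ι P hGZ hKo hGZK hmod
        ⟨h2, hKtc⟩ hHN hP hp2 hc hμ hA Gd Cd hGd hu hB _ hq0
    have hqq : q = q₁ := Rat.cast_injective (α := ℂ) (hq.symm.trans hq₁)
    rw [hqq, padicValRat_mul_tamagawaProduct_div_torsionOrder_sq G p hq₀0] at hval
    omega

/-! ## §2 The chain's currency: `hstep0` at `p = 3` -/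

/-- **STEP-0 in the currency of the KL3 END's binder `hstep0`** (parts 9 / 15 of o5-r2 GEN 21): under
`3 ∤ ∏_ℓ c_ℓ(G)`, `3 ∤ ∏_ℓ c_ℓ(G_d)` and `3 ∤ c(D′)` (the Manin constant `Dt.maninConstant = Dt.c`), §1
gives `ord₃ q₀ + ord₃ q₁ + 2·ord₃ ∏c(G) + 2·ord₃ c(D′) = 2·ord₃ [G(K) : ℤP′]` (all three extra terms
vanish). [cite: EdixhovenManin1991, §1]
[cite: GrossZagier1986, Thm. I.6.3 with V.§2 (pp. 310–312)] [cite: Miller2011LMS, Def. 1.1] -/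
theorem stepZero_three_of_heegner_pair
    (G : WeierstrassCurve ℚ) [G.IsElliptic] [G.IsGloballyMinimal]
    (N : ℕ) [NeZero N] (K : Type) [Field K] [NumberField K]
    (Dt : ModularParametrizationData G N) (H : HeegnerDatum N (NumberField.discr K)) (ι : K →+* ℂ)
    (P : (G.baseChange K).toAffine.Point)
    (hGZ : gross_zagier N G K) (hKo : kolyvagin N G K)
    (hGZK : rank_eq_analyticRank_of_analyticRank_le_one) (hmod : hasEntireLFunction_rat)
    (hK : IsImaginaryQuadratic K) (hHN : SatisfiesHeegnerHypothesis N K)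
    (hP : WeierstrassCurve.Affine.Point.map ι.toRatAlgHom P = heegnerPointComplex Dt H)
    (hPinf : ¬ IsOfFinAddOrder P)
    (hc : ¬ (3 : ℤ) ∣ Dt.maninConstant) (hμ : ¬ 3 ∣ Units.torsionOrder K)
    (hr : G.analyticRank ≤ 1)
    (Gd : WeierstrassCurve ℚ) [Gd.IsElliptic] [Gd.IsGloballyMinimal] (Cd : VariableChange ℚ)
    (hGd : Cd • G.quadraticTwist (NumberField.discr K : ℚ) = Gd)
    (hu : padicValRat 3 (Cd.u : ℚ) = 0) (hrd : Gd.analyticRank ≤ 1)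
    (htam : ¬ 3 ∣ G.tamagawaProduct) (htamd : ¬ 3 ∣ Gd.tamagawaProduct)
    {q₀ q₁ : ℚ} (hq₀ : shaAn G = (q₀ : ℂ)) (hq₁ : shaAn Gd = (q₁ : ℂ)) :
    padicValRat 3 q₀ + padicValRat 3 q₁ + ((2 * padicValNat 3 G.tamagawaProduct : ℕ) : ℤ) +
        ((2 * padicValInt 3 Dt.maninConstant : ℕ) : ℤ) =
      ((2 * padicValNat 3 (AddSubgroup.zmultiples P).index : ℕ) : ℤ) := by
  haveI : Fact (Nat.Prime 3) := ⟨Nat.prime_three⟩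
  have hval := padicVal_shaAn_pair_of_heegner G 3 N K Dt H ι P hGZ hKo hGZK hmod hK hHN hP hPinf
    (by norm_num) (by exact_mod_cast hc) hμ hr Gd Cd hGd hu hrd hq₀ hq₁
  have h1 : padicValNat 3 G.tamagawaProduct = 0 := padicValNat.eq_zero_of_not_dvd htam
  have h2 : padicValNat 3 Gd.tamagawaProduct = 0 := padicValNat.eq_zero_of_not_dvd htamd
  have h3 : padicValInt 3 Dt.maninConstant = 0 := padicValInt.eq_zero_of_not_dvd hc
  rw [h1, h2] at hval
  rw [h1, h3]
  simp only [Nat.cast_mul, Nat.cast_ofNat, Nat.cast_zero, mul_zero, add_zero] at hval ⊢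
  omega

end Summit.BirchSwinnertonDyer.Rank1Residual.O5.HeegnerLogTransport

end
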